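/-
Copyright (c) 2026 the pub-hodgecm-mathlib formalisation cell (harness21).  Prover seat hodgecm-mathlib-K2E1-p10 (g2), Track B ∕ K2-LIT (build stream 29),
h413 = `stmt-HodgeConjecture-24833`, route of record `HCCMUnconditional`, campaign «5Res (b) BL-2(χ,τ)»; dealer K2E1-plan (g6) deal (112) 2026-09-04T11:00:39Z
(SHEET (93)(b) row 11b: the B–L `𝔛`-system PACKAGE with a VECTOR unknown — twin of ★ G-b `locallyFiniteType_of_index` + ★ G-c `K2E1BLXSystemPackage`).
-/
import Summits.HodgeConjecture.HodgeConjecture.Theorems.K2E1BLXSystemPackage    -- ★ G-c (K2E3-p12 g7): the scalar package; brings ★ G-b `K2E1BLSystemAssembly` (§1 left inverse mod compacts, §2 transfer) and ★ P1b fred2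
import Mathlib.Topology.Algebra.Module.ContinuousLinearMap.PiProd
import HarnessLib

/-!
# h413 ∕ Track B «K2-LIT», campaign «5Res (b) BL-2(χ,τ)» — helper `K2E1BLXSystemPackageFinDimU` (SHEET row 11b): BERNSTEIN–LAPID'S `𝔛`-SYSTEM OF ONE BALL WITH A
# FINITE-DIMENSIONAL PARAMETER `b ∈ B` — `T_iψ = ĥ_i(z)ψ`, `P(ιψ) = φ₀α₁(z) + L(z)b`, `Qψ = 0` — PACKAGED AS ONE HOLOMORPHIC OPERATOR EQUATION, LOCALLY OF FINITE TYPE, UNIQUELY SOLVABLE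
# WHEN `L(z)` IS INJECTIVE — the (χ,τ) twin of ★ G-b §3 + ★ G-c (scalar `b : ℂ`, `α₂(z) ≠ 0`) [arXiv:1911.02342, §4 system `Ξ(s)`, Claims 3–5, p. 10]

Cell `pub/hodgecm-mathlib`, crux h413 = `stmt-HodgeConjecture-24833`, route of record `HCCMUnconditional`; chair K2-lead (g1), dealer K2E1-plan (g6) deal (112); sheet K2-defs1 (g6) rows 11∕11b
(l.11689: «unknown `(ψ, b) ∈ X × V′`, `P (ι ψ) = α₁ z + L_z b`, `L_z` INJECTIVE replacing `α₂ z ≠ 0`»).  THEOREMS ONLY (no `def`, no `instance`, no notation, no named-fact hypothesis, no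
`sorry`); lane `--supports stmt-HodgeConjecture-24833 --as helper` (count-neutral).  Closes no socket.  GENERIC operator theory (every space and operator an abstract letter).

THE MATHEMATICS [BernsteinLapid2019, §4].  For (χ,τ)-sections the constant term of `E(f_z^φ)` lies in `[f_z^φ] + V′_{1−z}`, `V′_{1−z}` the FINITE-DIMENSIONAL space of flat sections at `1 − z` of
`χʷ`-sections (rows 3, 9, 11), instead of the spherical line `ℂ·[H^{1−z}]`.  So the unknown of the ball system is a pair `(ψ, b) ∈ X × B` with `B` an abstract finite-dimensional normed space
(coordinates `B := ι → ℂ` over a basis of `V′`), the second exponent enters through a HOLOMORPHIC FAMILY `L : ℂ → (B →L V)` (`L(z)b = Σ_j b_j·α₂^j(z)`), the constant-term condition is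
`P(ιψ) = φ₀α₁(z) + L(z)b`, and the non-degeneracy letter «`α₂(z) ≠ 0`» becomes «`L(z)` injective» (linear independence of the `α₂^j(z)`).  Everything else is ★ G-b∕G-c VERBATIM: Claim 5's
auxiliary system `Ξ̃(z)` on `V × B` is left-invertible modulo compacts on `V` (★ `leftInvertible_modCompact_of_blReadouts`, readouts unchanged) and its `B`-component is trivially of finite type
(`B` finite-dimensional: the constant columns of a basis), so ★ fred2 `locallyFiniteType_prod_of_leftInvertible_modCompact` applies (ANY normed `𝓥₂`); the columns transfer back along
`Φ(f, b) = (πrf, b)` (★ `finiteType_transfer`).  Row 12 then calls ★ `exists_meromorphicOn_scalar_of_system'` with `𝓥 := X × B` exactly as ★ P8 §2 does with `X × ℂ`.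

* §1 **`locallyFiniteType_of_index_finDim`** — the `hfin` clause of ★ `exists_meromorphic_solution` at a point `z₀` with `ĥ(z₀) ≠ 0`, unknown `X × B`.
* §2 **`exists_xSystem_finDim`** — THE PACKAGE: `∃ A c`, both holomorphic on `D`, `A z (ψ, b) = c z ↔ (∀ i, T_iψ = ĥ_i(z)ψ) ∧ P(ιψ) = φ₀α₁(z) + L(z)b ∧ Qψ = 0`, and `hfin` on `D`.
* §3 `xSystem_b_unique_finDim`, **`xSystem_existsUnique_of_finDim`** (uniqueness of `ψ` + `L(z)` injective + a solution ⟹ `∃!`).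
* §4 COORDINATES `B := ι → ℂ`: `sum_proj_smulRight_apply` (`(Σ_j proj_j.smulRight (α₂ j z)) b = Σ_j b j • α₂ j z`), `differentiableOn_sum_proj_smulRight`, **`injective_sum_proj_smulRight_iff`**
  (`↔ LinearIndependent ℂ (fun j => α₂ j z)`); scalar sanity `injective_smulRight_one_iff` (`B = ℂ`: injective `↔ α₂ z ≠ 0`).

HONEST LABEL: HC_CM is proved only modulo the 7 printed citations (2 remaining named inputs: hLiu418 = `stmt-HodgeConjecture-24832`, h413 = `stmt-HodgeConjecture-24833`) until rung 0
closes; this file asserts no named fact and closes no socket.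
References: [BernsteinLapid2019] J. Bernstein, E. Lapid, *On the meromorphic continuation of Eisenstein series*, arXiv:1911.02342 (JAMS 37 (2024), doi:10.1090/jams/1020), §2.3–2.4, §4
Claims 3–5 and p. 10; [ReedSimonI1980] M. Reed, B. Simon, *Functional Analysis*, Thm. VI.13–VI.14.
-/

set_option autoImplicit false
-- the mandated namespace repeats `HodgeConjecture.HodgeConjecture`, as in every `Theorems/*.lean` of this sub-problem
set_option linter.dupNamespace false

noncomputable section

open Filter Topology Set Submodule Module
open scoped Classical
open Summit.HodgeConjecture.HodgeConjecture.Cruxes.H413.K2E1FredholmFiniteTypeCriterion (locallyFiniteType_prod_of_leftInvertible_modCompact)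
open Summit.HodgeConjecture.HodgeConjecture.Cruxes.H413.K2E1BLSystemAssembly (leftInvertible_modCompact_of_blReadouts finiteType_transfer)
open Summit.HodgeConjecture.HodgeConjecture.Cruxes.H413.K2E1BLXSystemPackage (sum_smul_single)

namespace Summit.HodgeConjecture.HodgeConjecture.Cruxes.H413.K2E1BLXSystemPackageFinDimU

/-! ## §1 Claim 5 + p. 10 with a finite-dimensional parameter: the system is locally of finite type where some `ĥ` does not vanish -/

/-- **THE FINITE-TYPE STEP, VECTOR PARAMETER** [BernsteinLapid2019, §4 Claim 5 and p. 10]: an ABSTRACT system `A z x = c z` in `x = (ψ, b) ∈ X × B`, `B` finite-dimensional, on an open `W₀ ∋ z₀`,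
whose solutions satisfy the readouts `Tψ = ĥ(z)ψ` and `P(ιψ) = φ₀α₁(z) + L(z)b`, with `ĥ(z₀) ≠ 0`, `L, α₁` holomorphic on `W₀`, `δ ∘ ι = r ∘ ι ∘ T`, `π ∘ r ∘ ι = 1`, `δ ∘ (1 − P)` compact (`V`
Hilbert) — satisfies ★ `exists_meromorphic_solution`'s `hfin` clause at `z₀`: `(ιψ, b)` solves the holomorphic auxiliary system `Ξ̃(z)` = (11)(12)(ct) on `V × B`, left-invertible modulo
compacts on `V` (★ `leftInvertible_modCompact_of_blReadouts`) with `B`-component trivially of finite type (constant columns of `Module.finBasis ℂ B`), hence locally of finite type (★ fred2);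
push back by `Φ(f, b) := (πrf, b)` (★ `finiteType_transfer`).  The twin of ★ `locallyFiniteType_of_index` (`B = ℂ`, `L(z)b = b·α₂(z)`). [cite: BernsteinLapid2019, §4 Claim 5 and p. 10]
[cite: ReedSimonI1980, Thm. VI.13] -/
theorem locallyFiniteType_of_index_finDim {X V V₀ 𝓦 B : Type*} [NormedAddCommGroup X] [NormedSpace ℂ X] [NormedAddCommGroup V] [InnerProductSpace ℂ V] [CompleteSpace V]
    [NormedAddCommGroup V₀] [NormedSpace ℂ V₀] [NormedAddCommGroup 𝓦] [NormedSpace ℂ 𝓦] [NormedAddCommGroup B] [NormedSpace ℂ B] [FiniteDimensional ℂ B]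
    {W₀ : Set ℂ} (hW₀ : IsOpen W₀) {z₀ : ℂ} (hz₀ : z₀ ∈ W₀) {A : ℂ → (X × B) →L[ℂ] 𝓦} {c : ℂ → 𝓦} (T : X →L[ℂ] X)
    {ĥ : ℂ → ℂ} (hĥ : DifferentiableOn ℂ ĥ W₀) (hĥ₀ : ĥ z₀ ≠ 0) (ι : X →L[ℂ] V) (P : V →L[ℂ] V) {α₁ : ℂ → V} (hα₁ : DifferentiableOn ℂ α₁ W₀)
    {L : ℂ → B →L[ℂ] V} (hL : DifferentiableOn ℂ L W₀) (φ₀ : ℂ) (δ r : V →L[ℂ] V₀) (π : V₀ →L[ℂ] X) (hδι : δ ∘L ι = r ∘L ι ∘L T)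
    (hπ : π ∘L r ∘L ι = ContinuousLinearMap.id ℂ X) (hK : IsCompactOperator (δ ∘L ((1 : V →L[ℂ] V) - P)))
    (hsolT : ∀ z ∈ W₀, ∀ x : X × B, A z x = c z → T x.1 = ĥ z • x.1) (hsolC : ∀ z ∈ W₀, ∀ x : X × B, A z x = c z → P (ι x.1) = φ₀ • α₁ z + L z x.2) :
    ∃ W ∈ 𝓝 z₀, ∃ n : ℕ, ∃ e : Fin n → ℂ → X × B, (∀ j, DifferentiableOn ℂ (e j) W) ∧ ∀ z ∈ W, ∀ x : X × B, A z x = c z → x ∈ span ℂ (Set.range fun j => e j z) := by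
  -- Claim 5's system `Ξ̃(z)` on `V × B`, valued in `V₀ × (V × V)`: (11) | (12) | (ct)
  obtain ⟨J₁, hJ₁⟩ : ∃ J₁ : V₀ →L[ℂ] V₀ × (V × V), J₁ = ContinuousLinearMap.inl ℂ V₀ (V × V) := ⟨_, rfl⟩
  obtain ⟨J₂, hJ₂⟩ : ∃ J₂ : V →L[ℂ] V₀ × (V × V), J₂ = ContinuousLinearMap.inr ℂ V₀ (V × V) ∘L ContinuousLinearMap.inl ℂ V V := ⟨_, rfl⟩
  obtain ⟨J₃, hJ₃⟩ : ∃ J₃ : V →L[ℂ] V₀ × (V × V), J₃ = ContinuousLinearMap.inr ℂ V₀ (V × V) ∘L ContinuousLinearMap.inr ℂ V V := ⟨_, rfl⟩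
  have hJ₁a : ∀ w, J₁ w = (w, (0, 0)) := fun w => by rw [hJ₁]; rfl
  have hJ₂a : ∀ v, J₂ v = (0, (v, 0)) := fun v => by rw [hJ₂]; rfl
  have hJ₃a : ∀ v, J₃ v = (0, (0, v)) := fun v => by rw [hJ₃]; rfl
  obtain ⟨AZ, hAZ⟩ : ∃ AZ : ℂ → (V × B) →L[ℂ] V₀ × (V × V), AZ = fun z =>
      J₁ ∘L ((δ - ĥ z • r) ∘L ContinuousLinearMap.fst ℂ V B) + J₂ ∘L ((ι ∘L π ∘L r - 1) ∘L ContinuousLinearMap.fst ℂ V B) +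
        J₃ ∘L (P ∘L ContinuousLinearMap.fst ℂ V B - L z ∘L ContinuousLinearMap.snd ℂ V B) := ⟨_, rfl⟩
  obtain ⟨cZ, hcZ⟩ : ∃ cZ : ℂ → V₀ × (V × V), cZ = fun z => J₃ (φ₀ • α₁ z) := ⟨_, rfl⟩
  have hAZa : ∀ z (f : V) (b : B), AZ z (f, b) = (δ f - ĥ z • r f, (ι (π (r f)) - f, P f - L z b)) := fun z f b => by
    rw [hAZ]
    simp only [add_apply, ContinuousLinearMap.comp_apply, ContinuousLinearMap.coe_fst', sub_apply, smul_apply,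
      one_apply_eq_self, ContinuousLinearMap.coe_snd', hJ₁a, hJ₂a, hJ₃a, Prod.mk_add_mk, add_zero, zero_add]
  have hcZa : ∀ z, cZ z = (0, (0, φ₀ • α₁ z)) := fun z => by rw [hcZ]; exact hJ₃a _
  -- `Ξ̃` is holomorphic
  have hAZd : DifferentiableOn ℂ AZ W₀ := by
    rw [hAZ]
    exact ((((differentiableOn_const J₁).clm_comp (((differentiableOn_const δ).sub (hĥ.smul (differentiableOn_const r))).clm_comp (differentiableOn_const _))).add
      ((differentiableOn_const J₂).clm_comp (differentiableOn_const _))).add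
        ((differentiableOn_const J₃).clm_comp ((differentiableOn_const _).sub (hL.clm_comp (differentiableOn_const _)))))
  have hcZd : DifferentiableOn ℂ cZ W₀ := by
    rw [hcZ]
    exact J₃.differentiable.comp_differentiableOn (hα₁.const_smul φ₀)
  -- left inverse modulo compacts at `z₀` (★ §1 with the readouts `fst`, `fst ∘ snd`, `snd ∘ snd`)
  have hleft : ∃ (D₀ : V₀ × (V × V) →L[ℂ] V) (K : V →L[ℂ] V), IsCompactOperator K ∧ D₀ ∘L ((AZ z₀) ∘L ContinuousLinearMap.inl ℂ V B) = 1 - K := by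
    refine leftInvertible_modCompact_of_blReadouts δ r ι π P hĥ₀ hK (ContinuousLinearMap.fst ℂ V₀ (V × V)) (ContinuousLinearMap.fst ℂ V V ∘L ContinuousLinearMap.snd ℂ V₀ (V × V))
      (ContinuousLinearMap.snd ℂ V V ∘L ContinuousLinearMap.snd ℂ V₀ (V × V)) ?_ ?_ ?_
    · ext f; simp only [ContinuousLinearMap.comp_apply, ContinuousLinearMap.inl_apply, hAZa, ContinuousLinearMap.coe_fst', sub_apply, smul_apply]
    · ext f; simp only [ContinuousLinearMap.comp_apply, ContinuousLinearMap.inl_apply, hAZa, ContinuousLinearMap.coe_fst', ContinuousLinearMap.coe_snd', sub_apply,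
        one_apply_eq_self]
    · ext f; simp only [ContinuousLinearMap.comp_apply, ContinuousLinearMap.inl_apply, hAZa, ContinuousLinearMap.coe_snd', map_zero, sub_zero]
  -- the `B`-component is trivially of finite type: the constant columns of a basis of the finite-dimensional `B`
  have hfin₂ : ∀ z ∈ W₀, ∀ x : V × B, AZ z x = cZ z → x.2 ∈ span ℂ (Set.range fun k : Fin (finrank ℂ B) => (finBasis ℂ B) k) := fun z _ x _ => by
    rw [(finBasis ℂ B).span_eq]; exact Submodule.mem_top
  obtain ⟨W, hW, n, e, he, hsolZ⟩ := locallyFiniteType_prod_of_leftInvertible_modCompact hW₀ hz₀ hAZd hcZd hleft (τ := fun k : Fin (finrank ℂ B) => fun _ : ℂ => (finBasis ℂ B) k)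
    (fun _ => differentiableOn_const _) hfin₂
  -- transfer back to `X × B` along `Φ(f, b) = (πrf, b)`
  have hπa : ∀ ψ : X, π (r (ι ψ)) = ψ := fun ψ => by
    have h := congrArg (fun f : X →L[ℂ] X => f ψ) hπ; simpa using h
  have hδιa : ∀ ψ : X, δ (ι ψ) = r (ι (T ψ)) := fun ψ => by
    have h := congrArg (fun f : X →L[ℂ] V₀ => f ψ) hδι; simpa using h
  obtain ⟨he', hsol'⟩ := finiteType_transfer ((π ∘L r).prodMap (ContinuousLinearMap.id ℂ B)) (W := W ∩ W₀) (fun j => (he j).mono Set.inter_subset_left)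
    (P' := fun z y => AZ z y = cZ z) (fun z hz y hy => hsolZ z hz.1 y hy) (P := fun z x => A z x = c z) fun z hz x hx => by
      refine ⟨(ι x.1, x.2), ?_, ?_⟩
      · rw [hAZa, hcZa, hδιa, hsolT z hz.2 x hx, hsolC z hz.2 x hx, hπa, map_smul, map_smul, sub_self, sub_self, add_sub_cancel_right]
      · show (π (r (ι x.1)), x.2) = x
        rw [hπa]
  exact ⟨W ∩ W₀, inter_mem hW (hW₀.mem_nhds hz₀), n, _, he', hsol'⟩

/-! ## §2 The package -/

/-- **THE `𝔛`-SYSTEM OF ONE BALL WITH A FINITE-DIMENSIONAL PARAMETER, PACKAGED** [BernsteinLapid2019, §4 system `Ξ(s)` p. 9, Claim 5 and p. 10].  Data: a finite index type `I`; normed `X`,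
Hilbert `V`, normed `X'`, `V₀ i`, finite-dimensional normed `B`; `T i : X →L X`, `ĥ i` holomorphic on the open `D` with `∀ z ∈ D, ∃ i, ĥ i z ≠ 0`; `ι, P, Q`; `α₁ : ℂ → V` and `L : ℂ → (B →L V)`
holomorphic on `D`; `φ₀ : ℂ`; per index the `Z`-letters `δ i, r i, π i` with `δ i ∘ ι = r i ∘ ι ∘ T i`, `π i ∘ r i ∘ ι = 1`, `δ i ∘ (1 − P)` compact.  THEN there are `A : ℂ → (X × B →L
(I → X) × V × X')` and `c`, BOTH HOLOMORPHIC on `D`, whose solutions are exactly the pairs `(ψ, b)` with `∀ i, T i ψ = ĥ i z • ψ`, `P (ι ψ) = φ₀ • α₁ z + L z b`, `Q ψ = 0`, and which satisfy the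
`hfin` clause at every point of `D` (§1 at an index with `ĥ i z₀ ≠ 0`).  (`A z := A₀ − Σ_i ĥ i z • B_i − J₂ ∘ L z ∘ snd`, `c z := J₂(φ₀ • α₁ z)`.)  The twin of ★ `exists_xSystem`.
[cite: BernsteinLapid2019, §4 pp. 9–10] -/
theorem exists_xSystem_finDim {I : Type*} [Fintype I] {X V X' B : Type*} [NormedAddCommGroup X] [NormedSpace ℂ X] [NormedAddCommGroup V] [InnerProductSpace ℂ V] [CompleteSpace V]
    [NormedAddCommGroup X'] [NormedSpace ℂ X'] [NormedAddCommGroup B] [NormedSpace ℂ B] [FiniteDimensional ℂ B] {V₀ : I → Type*} [∀ i, NormedAddCommGroup (V₀ i)]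
    [∀ i, NormedSpace ℂ (V₀ i)] {D : Set ℂ} (hD : IsOpen D) (T : I → X →L[ℂ] X)
    {ĥ : I → ℂ → ℂ} (hĥ : ∀ i, DifferentiableOn ℂ (ĥ i) D) (hcov : ∀ z ∈ D, ∃ i, ĥ i z ≠ 0) (ι : X →L[ℂ] V) (P : V →L[ℂ] V) (Q : X →L[ℂ] X') {α₁ : ℂ → V}
    (hα₁ : DifferentiableOn ℂ α₁ D) {L : ℂ → B →L[ℂ] V} (hL : DifferentiableOn ℂ L D) (φ₀ : ℂ) (δ r : ∀ i, V →L[ℂ] V₀ i) (π : ∀ i, V₀ i →L[ℂ] X)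
    (hδι : ∀ i, δ i ∘L ι = r i ∘L ι ∘L T i) (hπ : ∀ i, π i ∘L r i ∘L ι = ContinuousLinearMap.id ℂ X) (hK : ∀ i, IsCompactOperator (δ i ∘L ((1 : V →L[ℂ] V) - P))) :
    ∃ (A : ℂ → (X × B) →L[ℂ] (I → X) × (V × X')) (c : ℂ → (I → X) × (V × X')), DifferentiableOn ℂ A D ∧ DifferentiableOn ℂ c D ∧
      (∀ (z : ℂ) (ψ : X) (b : B), A z (ψ, b) = c z ↔ (∀ i, T i ψ = ĥ i z • ψ) ∧ P (ι ψ) = φ₀ • α₁ z + L z b ∧ Q ψ = 0) ∧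
      ∀ z₀ ∈ D, ∃ W ∈ 𝓝 z₀, ∃ n : ℕ, ∃ e : Fin n → ℂ → X × B, (∀ j, DifferentiableOn ℂ (e j) W) ∧
        ∀ z ∈ W, ∀ x : X × B, A z x = c z → x ∈ span ℂ (Set.range fun j => e j z) := by
  -- the three injections into `𝓦 := (I → X) × (V × X')`
  obtain ⟨J₁, hJ₁⟩ : ∃ J₁ : (I → X) →L[ℂ] (I → X) × (V × X'), J₁ = ContinuousLinearMap.inl ℂ (I → X) (V × X') := ⟨_, rfl⟩
  obtain ⟨J₂, hJ₂⟩ : ∃ J₂ : V →L[ℂ] (I → X) × (V × X'), J₂ = ContinuousLinearMap.inr ℂ (I → X) (V × X') ∘L ContinuousLinearMap.inl ℂ V X' := ⟨_, rfl⟩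
  obtain ⟨J₃, hJ₃⟩ : ∃ J₃ : X' →L[ℂ] (I → X) × (V × X'), J₃ = ContinuousLinearMap.inr ℂ (I → X) (V × X') ∘L ContinuousLinearMap.inr ℂ V X' := ⟨_, rfl⟩
  have hJ₁a : ∀ w, J₁ w = (w, (0, 0)) := fun w => by rw [hJ₁]; rfl
  have hJ₂a : ∀ v, J₂ v = (0, (v, 0)) := fun v => by rw [hJ₂]; rfl
  have hJ₃a : ∀ v, J₃ v = (0, (0, v)) := fun v => by rw [hJ₃]; rfl
  -- the constant part `A₀`, the coordinate operators `B i`, and the system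
  obtain ⟨A₀, hA₀⟩ : ∃ A₀ : (X × B) →L[ℂ] (I → X) × (V × X'), A₀ = J₁ ∘L (ContinuousLinearMap.pi fun i => T i) ∘L ContinuousLinearMap.fst ℂ X B +
      J₂ ∘L P ∘L ι ∘L ContinuousLinearMap.fst ℂ X B + J₃ ∘L Q ∘L ContinuousLinearMap.fst ℂ X B := ⟨_, rfl⟩
  obtain ⟨Bop, hBop⟩ : ∃ Bop : I → (X × B) →L[ℂ] (I → X) × (V × X'), Bop = fun i => J₁ ∘L ContinuousLinearMap.single ℂ (fun _ : I => X) i ∘L ContinuousLinearMap.fst ℂ X B := ⟨_, rfl⟩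
  obtain ⟨A, hA⟩ : ∃ A : ℂ → (X × B) →L[ℂ] (I → X) × (V × X'), A = fun z => A₀ - (∑ i, ĥ i z • Bop i) - J₂ ∘L L z ∘L ContinuousLinearMap.snd ℂ X B := ⟨_, rfl⟩
  obtain ⟨c, hc⟩ : ∃ c : ℂ → (I → X) × (V × X'), c = fun z => J₂ (φ₀ • α₁ z) := ⟨_, rfl⟩
  have hA₀a : ∀ (ψ : X) (b : B), A₀ (ψ, b) = ((fun i => T i ψ), (P (ι ψ), Q ψ)) := fun ψ b => by
    rw [hA₀]
    simp only [add_apply, ContinuousLinearMap.comp_apply, ContinuousLinearMap.coe_fst', ContinuousLinearMap.coe_pi', hJ₁a, hJ₂a, hJ₃a, Prod.mk_add_mk, add_zero, zero_add]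
  have hBa : ∀ i (ψ : X) (b : B), Bop i (ψ, b) = ((Pi.single i ψ : I → X), ((0 : V), (0 : X'))) := fun i ψ b => by
    rw [hBop]
    simp only [ContinuousLinearMap.comp_apply, ContinuousLinearMap.coe_fst', hJ₁a]
    rfl
  have hsum : ∀ (z : ℂ) (ψ : X) (b : B), (∑ i, ĥ i z • Bop i) (ψ, b) = ((fun j => ĥ j z • ψ), ((0 : V), (0 : X'))) := fun z ψ b => by
    rw [sum_apply]
    simp only [smul_apply, hBa]
    ext j
    · rw [Prod.fst_sum]
      simp only [Prod.smul_fst]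
      rw [sum_smul_single]
    · rw [Prod.snd_sum]; simp only [Prod.smul_snd, Prod.mk_zero_zero, smul_zero, Finset.sum_const_zero, Prod.fst_zero]
    · rw [Prod.snd_sum]; simp only [Prod.smul_snd, Prod.mk_zero_zero, smul_zero, Finset.sum_const_zero, Prod.snd_zero]
  have hAa : ∀ (z : ℂ) (ψ : X) (b : B), A z (ψ, b) = ((fun i => T i ψ - ĥ i z • ψ), (P (ι ψ) - L z b, Q ψ)) := fun z ψ b => by
    rw [hA]
    simp only [sub_apply, hA₀a, hsum, ContinuousLinearMap.comp_apply, ContinuousLinearMap.coe_snd', hJ₂a, Prod.mk_sub_mk, sub_zero]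
    rfl
  have hca : ∀ z, c z = (0, (φ₀ • α₁ z, 0)) := fun z => by rw [hc]; exact hJ₂a _
  -- solution characterisation
  have hchar : ∀ (z : ℂ) (ψ : X) (b : B), A z (ψ, b) = c z ↔ (∀ i, T i ψ = ĥ i z • ψ) ∧ P (ι ψ) = φ₀ • α₁ z + L z b ∧ Q ψ = 0 := fun z ψ b => by
    rw [hAa, hca, Prod.mk.injEq, Prod.mk.injEq]
    constructor
    · rintro ⟨h1, h2, h3⟩
      exact ⟨fun i => sub_eq_zero.1 (by simpa using congrFun h1 i), sub_eq_iff_eq_add.1 h2, h3⟩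
    · rintro ⟨h1, h2, h3⟩
      exact ⟨funext fun i => by simpa [sub_eq_zero] using h1 i, sub_eq_iff_eq_add.2 h2, h3⟩
  refine ⟨A, c, ?_, ?_, hchar, fun z₀ hz₀ => ?_⟩
  · -- `A` is holomorphic on `D`
    rw [hA]
    exact ((differentiableOn_const A₀).sub (DifferentiableOn.fun_sum fun i _ => (hĥ i).smul (differentiableOn_const (Bop i)))).sub
      (((differentiableOn_const J₂).clm_comp hL).clm_comp (differentiableOn_const _))
  · -- `c` is holomorphic on `D`
    rw [hc]
    exact J₂.differentiable.comp_differentiableOn (hα₁.const_smul φ₀)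
  · -- `hfin` at `z₀`: §1 at an index `i` with `ĥ i z₀ ≠ 0`
    obtain ⟨i, hi⟩ := hcov z₀ hz₀
    exact locallyFiniteType_of_index_finDim hD hz₀ (T i) (hĥ i) hi ι P hα₁ hL φ₀ (δ i) (r i) (π i) (hδι i) (hπ i) (hK i)
      (fun z _ x hx => ((hchar z x.1 x.2).1 hx).1 i) (fun z _ x hx => ((hchar z x.1 x.2).1 hx).2.1)

/-! ## §3 Bookkeeping for `hunq`: the `b`-component is determined by `ψ` when `L(z)` is injective -/

/-- If `L` is injective, the parameter `b` in `p = a + L b` is determined by `p`, `a`. [folklore] -/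
theorem xSystem_b_unique_finDim {V B : Type*} [AddCommGroup V] [Module ℂ V] [AddCommGroup B] [Module ℂ B] {L : B →ₗ[ℂ] V} (hL : Function.Injective L) {p a : V} {b b' : B}
    (h : p = a + L b) (h' : p = a + L b') : b = b' :=
  hL (add_left_cancel (h.symm.trans h'))

/-- **`hunq` FROM UNIQUENESS OF `ψ`, VECTOR PARAMETER**: if at `z` every solution `(ψ, b)` of the packaged system has `ψ = ψ₀` (★ P6-type uniqueness), if `(ψ₀, b₀)` is a solution and `L(z)` is
injective, then the solution is unique: `∃! x, A z x = c z` — the twin of ★ `xSystem_existsUnique_of` (`α₂ z ≠ 0`). [cite: BernsteinLapid2019, §4 Claim 2] -/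
theorem xSystem_existsUnique_of_finDim {I : Type*} {X V X' 𝓦 B : Type*} [NormedAddCommGroup X] [NormedSpace ℂ X] [NormedAddCommGroup V] [NormedSpace ℂ V] [NormedAddCommGroup X']
    [NormedSpace ℂ X'] [NormedAddCommGroup 𝓦] [NormedSpace ℂ 𝓦] [NormedAddCommGroup B] [NormedSpace ℂ B] {A : ℂ → (X × B) →L[ℂ] 𝓦} {c : ℂ → 𝓦} {T : I → X →L[ℂ] X}
    {ĥ : I → ℂ → ℂ} {ι : X →L[ℂ] V} {P : V →L[ℂ] V} {Q : X →L[ℂ] X'} {α₁ : ℂ → V} {L : ℂ → B →L[ℂ] V} {φ₀ : ℂ}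
    (hchar : ∀ (z : ℂ) (ψ : X) (b : B), A z (ψ, b) = c z ↔ (∀ i, T i ψ = ĥ i z • ψ) ∧ P (ι ψ) = φ₀ • α₁ z + L z b ∧ Q ψ = 0) {z : ℂ} (hLz : Function.Injective (L z))
    {ψ₀ : X} {b₀ : B} (hsol : A z (ψ₀, b₀) = c z) (hψ : ∀ (ψ : X) (b : B), A z (ψ, b) = c z → ψ = ψ₀) : ∃! x : X × B, A z x = c z := by
  refine ⟨(ψ₀, b₀), hsol, fun x hx => ?_⟩
  have hψx : x.1 = ψ₀ := hψ x.1 x.2 hx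
  have hb : x.2 = b₀ := by
    have h1 := ((hchar z x.1 x.2).1 hx).2.1
    have h0 := ((hchar z ψ₀ b₀).1 hsol).2.1
    rw [hψx] at h1
    exact xSystem_b_unique_finDim (L := ((L z : B →L[ℂ] V) : B →ₗ[ℂ] V)) hLz h1 h0
  exact Prod.ext hψx hb

/-! ## §4 Coordinates `B := ι → ℂ`: `L(z) = Σ_j proj_j.smulRight (α₂ j z)` -/

section Coordinates

variable {ι' : Type*} [Fintype ι'] {V : Type*} [NormedAddCommGroup V] [NormedSpace ℂ V]

/-- **`(Σ_j proj_j.smulRight (α₂ j z)) b = Σ_j b j • α₂ j z`** — the coordinate family of CLMs `(ι → ℂ) →L V`. [folklore] -/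
theorem sum_proj_smulRight_apply (α₂ : ι' → ℂ → V) (z : ℂ) (b : ι' → ℂ) :
    (∑ j, (ContinuousLinearMap.proj (R := ℂ) (φ := fun _ : ι' => ℂ) j).smulRight (α₂ j z)) b = ∑ j, b j • α₂ j z := by
  rw [sum_apply]
  exact Finset.sum_congr rfl fun j _ => by simp only [ContinuousLinearMap.smulRight_apply, ContinuousLinearMap.proj_apply]

/-- The coordinate family is holomorphic where every `α₂ j` is. [folklore] -/
theorem differentiableOn_sum_proj_smulRight {α₂ : ι' → ℂ → V} {D : Set ℂ} (hα₂ : ∀ j, DifferentiableOn ℂ (α₂ j) D) :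
    DifferentiableOn ℂ (fun z => ∑ j, (ContinuousLinearMap.proj (R := ℂ) (φ := fun _ : ι' => ℂ) j).smulRight (α₂ j z)) D := by
  refine DifferentiableOn.fun_sum fun j _ => ?_
  have h := (ContinuousLinearMap.smulRightL ℂ (ι' → ℂ) V (ContinuousLinearMap.proj (R := ℂ) (φ := fun _ : ι' => ℂ) j)).differentiable.comp_differentiableOn (hα₂ j)
  refine h.congr fun z _ => ContinuousLinearMap.ext fun x => ?_
  simp only [Function.comp_apply, ContinuousLinearMap.smulRightL_apply_apply, ContinuousLinearMap.smulRight_apply]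

/-- **THE NON-DEGENERACY LETTER IN COORDINATES**: `L(z) = Σ_j proj_j.smulRight (α₂ j z)` is injective iff the vectors `(α₂ j z)_j` are linearly independent (Mathlib `Fintype.linearIndependent_iff`).
[cite: BernsteinLapid2019, §4 Claim 2] -/
theorem injective_sum_proj_smulRight_iff (α₂ : ι' → ℂ → V) (z : ℂ) :
    Function.Injective ((∑ j, (ContinuousLinearMap.proj (R := ℂ) (φ := fun _ : ι' => ℂ) j).smulRight (α₂ j z) : (ι' → ℂ) →L[ℂ] V) : (ι' → ℂ) → V) ↔
      LinearIndependent ℂ (fun j => α₂ j z) := by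
  rw [Fintype.linearIndependent_iff]
  constructor
  · intro h g hg j
    have h0 : g = 0 := h (by rw [sum_proj_smulRight_apply, map_zero]; exact hg)
    rw [h0]; rfl
  · intro h g g' hgg'
    have h0 : (∑ j, (ContinuousLinearMap.proj (R := ℂ) (φ := fun _ : ι' => ℂ) j).smulRight (α₂ j z) : (ι' → ℂ) →L[ℂ] V) (g - g') = 0 := by
      rw [map_sub, hgg', sub_self]
    rw [sum_proj_smulRight_apply] at h0
    funext j
    exact sub_eq_zero.1 (by simpa only [Pi.sub_apply] using h (g - g') h0 j)

/-- **SCALAR SANITY (`B = ℂ`)**: `b ↦ b • α₂(z)` (= `(1 : ℂ →L ℂ).smulRight (α₂ z)`) is injective iff `α₂(z) ≠ 0` — the letter of ★ `xSystem_existsUnique_of`. [folklore] -/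
theorem injective_smulRight_one_iff (α : V) : Function.Injective ((1 : ℂ →L[ℂ] ℂ).smulRight α) ↔ α ≠ 0 := by
  constructor
  · intro h hα
    have h1 : ((1 : ℂ →L[ℂ] ℂ).smulRight α) 1 = ((1 : ℂ →L[ℂ] ℂ).smulRight α) 0 := by
      simp only [ContinuousLinearMap.smulRight_apply, one_apply_eq_self, hα, smul_zero]
    exact one_ne_zero (h h1)
  · intro hα b b' h
    simp only [ContinuousLinearMap.smulRight_apply, one_apply_eq_self] at h
    exact smul_left_injective ℂ hα h

end Coordinates

end Summit.HodgeConjecture.HodgeConjecture.Cruxes.H413.K2E1BLXSystemPackageFinDimU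

end
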